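import Mathlib
import Literature.Barriers.ValiantsHypothesis.AlgebraicNaturalProofs
import Literature.Computability.AlgebraicComplexity.ApolarityAction
import Summits.ValiantsHypothesis.ValiantsHypothesis.Theorems.BarrierLeverSuccinctHittingSetsForVPStubDerivDimension
import HarnessLib

/-!
# Crux `BarrierLever.SuccinctHittingSetsForVP` (stmt-ValiantsHypothesis-14610), line `registered` —
STUB `stub_partialsIndependent`: ORDER-`k` PARTIALS OF THE ALL-ONES POLYNOMIAL ARE INDEPENDENT

**What is proved (it does NOT close the item, it discharges the registered stub
`stub_partialsIndependent` = STUB PD2 of wave 5 of the skeleton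
`Cruxes/SuccinctHittingSetsForVP/Lines/birth.lean`, CONDITIONALLY on the verbatim statement of
STUB PD1 `stub_risingDiagonal`, taken as the first hypothesis).** Let `f` be a polynomial over `ℂ`
in the variables `x_0, …, x_{n-1}` all of whose coefficients in degree `≤ n` equal `1`, and let
`2k ≤ n`. Then the order-`k` partial derivatives `∂^u f = x^u ⌟ f` (`apolarAction`), `|u| = k`, are
linearly independent.

Proof: in a vanishing combination `Σ_u g_u ∂^u f = 0` read off the coefficient of `x^w` for
`|w| ≤ k`; since `|w + u| ≤ 2k ≤ n` the coefficient of `x^{w+u}` in `f` is `1`, so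
(`DerivDimension.coeff_apolarAction_monomial_one`) one gets the linear relations
`Σ_u g_u ∏_i (w_i+u_i)!/w_i! = 0` (`|w| ≤ k`). For `|v| = k` apply the signed binomial sum
`Σ_{w ≤ v} (-1)^{|v-w|} ∏_i C(v_i, w_i) (·)`: by PD1 (rising-factorial finite differences are
diagonal on a degree slice) the result is `g_v ∏_i v_i!`, whence `g_v = 0`.

* `PartialsIndependent.coeff_apolarAction_monomial_one_eq_prod` : the coefficient formula
  `coeff_w (∂^u f) = ∏_i descFactorial (w_i + u_i) u_i` whenever `|w + u| ≤ n`;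
* `PartialsIndependent.prod_factorial_ne_zero` : `∏_i v_i! ≠ 0` in `ℂ`;
* `stub_partialsIndependent` (registered stub).

Folklore (Nisan–Wigderson 1996 partial-derivative measure; Iarrobino–Kanev §1.1 for the apolar
action). Axioms: `propext`, `Classical.choice`, `Quot.sound`.
-/

-- layout Summits/ValiantsHypothesis/ValiantsHypothesis forces the duplicated namespace component
set_option linter.dupNamespace false

namespace Summit.ValiantsHypothesis.ValiantsHypothesis.Theorems.BarrierLever.SuccinctHittingSetsForVP

open Literature.Barriers.ValiantsHypothesis Literature.Computability.AlgebraicComplexity MvPolynomial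

namespace PartialsIndependent

/-- **Coefficients of the partials of the all-ones polynomial.** If every coefficient of `f` in
degree `≤ n` is `1` and `|w + u| ≤ n`, then the coefficient of `x^w` in `∂^u f = x^u ⌟ f` is
`∏_i descFactorial (w_i + u_i) u_i = ∏_i (w_i+u_i)!/w_i!`. [folklore] -/
theorem coeff_apolarAction_monomial_one_eq_prod {n : ℕ} {f : MvPolynomial (Fin n) ℂ}
    (hcoef : ∀ m : Fin n →₀ ℕ, m.degree ≤ n → coeff m f = 1)
    (u w : Fin n →₀ ℕ) (h : (w + u).degree ≤ n) :
    coeff w (apolarAction (monomial u (1 : ℂ)) f) =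
      ∏ i, (Nat.descFactorial (w i + u i) (u i) : ℂ) := by
  rw [DerivDimension.coeff_apolarAction_monomial_one, hcoef _ h, one_mul,
    Finset.prod_subset (Finset.subset_univ u.support)]
  · exact Finset.prod_congr rfl fun i _ => by rw [Finsupp.add_apply]
  · intro i _ hi
    rw [Finsupp.notMem_support_iff.mp hi, Nat.descFactorial_zero, Nat.cast_one]

/-- A product of factorials is nonzero in `ℂ`. [folklore] -/
theorem prod_factorial_ne_zero {n : ℕ} (v : Fin n →₀ ℕ) :
    (∏ i, ((v i).factorial : ℂ)) ≠ 0 :=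
  Finset.prod_ne_zero_iff.mpr fun _ _ => Nat.cast_ne_zero.mpr (Nat.factorial_ne_zero _)

end PartialsIndependent

open PartialsIndependent in
/-- **STUB PD2 (order-`k` partials of the all-ones polynomial are independent), conditional on
PD1 verbatim.** If every coefficient of `f` in degree `≤ n` equals `1` and `2k ≤ n`, the partial
derivatives `∂^u f = x^u ⌟ f`, `|u| = k`, are linearly independent: apply the signed binomial sums
of PD1 to the coefficient relations `Σ_u g_u ∏_i (w_i+u_i)!/w_i! = 0` (`|w| ≤ k`) of a vanishing
combination `Σ_u g_u ∂^u f = 0`. [folklore] -/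
theorem stub_partialsIndependent :
    (∀ (n : ℕ) (u v : Fin n →₀ ℕ), u.degree = v.degree →
      (∑ w ∈ Finset.Iic v, (-1 : ℂ) ^ (v - w).degree *
          (∏ i, (Nat.choose (v i) (w i) : ℂ)) * ∏ i, (Nat.descFactorial (w i + u i) (u i) : ℂ)) =
        if u = v then ∏ i, ((u i).factorial : ℂ) else 0) →
    ∀ (n k : ℕ) (f : MvPolynomial (Fin n) ℂ), 2 * k ≤ n →
      (∀ m : Fin n →₀ ℕ, m.degree ≤ n → MvPolynomial.coeff m f = 1) →
      LinearIndependent ℂ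
        (fun u : {u : Fin n →₀ ℕ // u.degree = k} => apolarAction (monomial u.1 (1 : ℂ)) f) := by
  intro hD n k f hk hcoef
  rw [linearIndependent_iff']
  intro s g hsum v hv
  -- the coefficient relations: `Σ_u g_u ∏_i (w_i+u_i)!/w_i! = 0` for every `|w| ≤ k`
  have E : ∀ w : Fin n →₀ ℕ, w.degree ≤ k →
      ∑ u ∈ s, g u * ∏ i, (Nat.descFactorial (w i + u.1 i) (u.1 i) : ℂ) = 0 := by
    intro w hw
    have key := congrArg (coeff w) hsum
    rw [coeff_sum, coeff_zero] at key
    rw [← key]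
    refine Finset.sum_congr rfl fun u _ => ?_
    have hdeg : (w + u.1).degree ≤ n := by
      rw [map_add]
      have hu := u.2
      omega
    rw [coeff_smul, smul_eq_mul, coeff_apolarAction_monomial_one_eq_prod hcoef u.1 w hdeg]
  -- apply the signed binomial sum over `w ≤ v` and swap the sums
  have hS : ∑ u ∈ s, g u * ∑ w ∈ Finset.Iic v.1, (-1 : ℂ) ^ (v.1 - w).degree *
      (∏ i, (Nat.choose (v.1 i) (w i) : ℂ)) *
        ∏ i, (Nat.descFactorial (w i + u.1 i) (u.1 i) : ℂ) = 0 := by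
    rw [Finset.sum_congr rfl fun u _ => Finset.mul_sum _ _ _,
      Finset.sum_comm (s := s) (t := Finset.Iic v.1)]
    refine Finset.sum_eq_zero fun w hw => ?_
    have hw' : w.degree ≤ k :=
      (Finsupp.degree_mono (Finset.mem_Iic.mp hw)).trans_eq v.2
    calc ∑ u ∈ s, g u * ((-1 : ℂ) ^ (v.1 - w).degree *
          (∏ i, (Nat.choose (v.1 i) (w i) : ℂ)) *
            ∏ i, (Nat.descFactorial (w i + u.1 i) (u.1 i) : ℂ))
        = (-1 : ℂ) ^ (v.1 - w).degree * (∏ i, (Nat.choose (v.1 i) (w i) : ℂ)) *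
            ∑ u ∈ s, g u * ∏ i, (Nat.descFactorial (w i + u.1 i) (u.1 i) : ℂ) := by
          rw [Finset.mul_sum]
          exact Finset.sum_congr rfl fun u _ => by ring
      _ = 0 := by rw [E w hw', mul_zero]
  -- by PD1 only the term `u = v` survives: `g_v ∏_i v_i! = 0`
  rw [Finset.sum_eq_single v (fun u _ huv => by
      rw [hD n u.1 v.1 (u.2.trans v.2.symm), if_neg (fun h => huv (Subtype.ext h)), mul_zero])
    (fun hv' => absurd hv hv'), hD n v.1 v.1 rfl, if_pos rfl] at hS
  exact (mul_eq_zero.mp hS).resolve_right (prod_factorial_ne_zero v.1)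

end Summit.ValiantsHypothesis.ValiantsHypothesis.Theorems.BarrierLever.SuccinctHittingSetsForVP
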